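import Summits.AtomisticToContinuum.HydrodynamicLimit.Theorems.LambertianContactSwapLambertianEulerHeartsLog
import Summits.AtomisticToContinuum.HydrodynamicLimit.Theorems.LambertianContactSwapLambertianEulerEstimateOfHearts
import Summits.AtomisticToContinuum.HydrodynamicLimit.Theorems.LambertianContactSwapLambertianEulerBootstrapConsts
import HarnessLib

/-!
# Log-hearts ⇒ guarded ESTIMATE: the in-window bootstrap of the Lambertian entropy clock in the log-shell (line `Sketch`, crux stmt-11854)

Support file (`--supports stmt-AtomisticToContinuum-11854`).  `windowProductionEstimateLambdaInBand_of_heartsLog`: the two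
LOG-SHELL hearts P3Λ-log / P4Λ-log (`…LambertianEulerHeartsLog`) imply the PACKING-GUARDED one-window production ESTIMATE for `Λ`
(`WindowProductionEstimateLambdaInBand`) — with NO dilute self-consistency: the packing guard of the re-typed conjunct (D-0032)
supplies the bands that stmt-3091 used to supply (`ηg := min ηb (min η3 (min η4 ηF))`: B2's band, the hearts' bands, the analytic
insertion factor's band).  The bootstrap is lead c5/c6's (`…EstimateOfHearts`) with the constants re-threaded for a rate chosen
AFTER the tolerance: given `κ > 0`, the hearts are called with `κ/16` at tolerance `ε₁ := ε⁴`, so `C = C₃ + C₄ ≤ (κ/2)|log ε|` and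
`A = 2C ≤ κ |log ε|`; the window is `w := min 1 (ε/(2C²C₀ + 2CC₀ + C + 1))` and the pure-ℝ consistency
(`C²C₀w ≤ ε/2`, `CC₀w ≤ ε/2`, `2ε₁(Cw+1) ≤ wε/2` once `8ε(2C₀κ² + 2C₀κ + κ + 1) ≤ 1`) is `…BootstrapConsts.bootstrap_consts`.
Lead prover-line-stmt-AtomisticToContinuum-11854-c7-0, 2026-08-17.  [cite: Yau1991, §2]
-/

noncomputable section

namespace Summit.AtomisticToContinuum.HydrodynamicLimit.Theorems.LambertianContactSwapLambertianEulerEstimateOfHeartsLog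

open scoped BigOperators Topology ENNReal InnerProductSpace
open MeasureTheory ProbabilityTheory Filter Set InformationTheory
open Literature.MathematicalPhysics.KineticTheory
open Literature.Analysis.FluidPDE Literature.Analysis.FluidPDE.Alexander
open Summit.AtomisticToContinuum.HydrodynamicLimit.Theorems.ClampedCurrentsDockPathwise (gSum DgSum)
open Summit.AtomisticToContinuum.HydrodynamicLimit.Theorems.LambertianContactSwapLambertianEulerHearts
open Summit.AtomisticToContinuum.HydrodynamicLimit.Theorems.LambertianContactSwapLambertianEulerHeartsLog
open Summit.AtomisticToContinuum.HydrodynamicLimit.Theorems.LambertianContactSwapLambertianEulerEstimateOfHearts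
open Summit.AtomisticToContinuum.HydrodynamicLimit.Theorems.LambertianContactSwapLambertianEulerBootstrapConsts

/-! ## §1 Pure-ℝ bookkeeping with inequalities -/

/-- Full window, inequality form of `estimate_arith_full`: `P ≤ C w (H + C w C₀ n + 2ε₁ n) + 2ε₁ n`, `C²C₀w ≤ ε/2`,
`2ε₁(Cw+1) ≤ wε/2` give `P ≤ 2Cw H + w n ε`. [folklore] -/
theorem estimate_arith_full_le {P H C C₀ w ε ε₁ n : ℝ} (hC : 0 ≤ C) (hw : 0 < w) (hn : 0 < n) (hH : 0 ≤ H)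
    (hfin : P ≤ C * w * (H + C * w * (C₀ * n) + 2 * ε₁ * n) + 2 * ε₁ * n) (hk1 : C ^ 2 * C₀ * w ≤ ε / 2)
    (hk2 : 2 * ε₁ * (C * w + 1) ≤ w * ε / 2) : P ≤ 2 * C * w * H + w * n * ε := by
  have hA : C * w * H ≤ 2 * C * w * H := by nlinarith [mul_nonneg (mul_nonneg hC hw.le) hH]
  have hB : C * w * (C * w * (C₀ * n)) ≤ w * n * (ε / 2) := by
    have : C * w * (C * w * (C₀ * n)) = w * n * (C ^ 2 * C₀ * w) := by ring
    rw [this]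
    exact mul_le_mul_of_nonneg_left hk1 (by positivity)
  have hCε : C * w * (2 * ε₁ * n) + 2 * ε₁ * n ≤ w * n * (ε / 2) := by
    have h1 : C * w * (2 * ε₁ * n) + 2 * ε₁ * n = (2 * ε₁ * (C * w + 1)) * n := by ring
    have h2 : w * n * (ε / 2) = (w * ε / 2) * n := by ring
    rw [h1, h2]
    exact mul_le_mul_of_nonneg_right hk2 hn.le
  have hdist : C * w * (H + C * w * (C₀ * n) + 2 * ε₁ * n) =
      C * w * H + C * w * (C * w * (C₀ * n)) + C * w * (2 * ε₁ * n) := by ring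
  linarith

/-- Last partial window, inequality form of `estimate_arith_partial`: `P ≤ C d C₀ n + 2ε₁ n`, `d ≤ w ≤ 1`, `C C₀ w ≤ ε/2`,
`2ε₁(Cw+1) ≤ wε/2` give `P ≤ n ε`. [folklore] -/
theorem estimate_arith_partial_le {P C C₀ w ε ε₁ n d : ℝ} (hC : 0 ≤ C) (hC₀ : 0 ≤ C₀) (hw : 0 < w) (hw1 : w ≤ 1)
    (hn : 0 < n) (hε : 0 < ε) (hε₁ : 0 ≤ ε₁) (hd : d ≤ w) (hp : P ≤ C * d * (C₀ * n) + 2 * ε₁ * n)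
    (hk1 : C * C₀ * w ≤ ε / 2) (hk2 : 2 * ε₁ * (C * w + 1) ≤ w * ε / 2) : P ≤ n * ε := by
  have hcr : C * d * (C₀ * n) ≤ C * w * (C₀ * n) := by
    have h0 : 0 ≤ C * (C₀ * n) := by positivity
    nlinarith
  have hB : C * w * (C₀ * n) ≤ n * (ε / 2) := by
    have : C * w * (C₀ * n) = n * (C * C₀ * w) := by ring
    rw [this]
    exact mul_le_mul_of_nonneg_left hk1 hn.le
  have hE2 : 2 * ε₁ ≤ ε / 2 := by
    have h3 : 2 * ε₁ ≤ 2 * ε₁ * (C * w + 1) := by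
      have := mul_nonneg hC hw.le
      nlinarith
    have h4 : w * ε / 2 ≤ ε / 2 := by nlinarith
    linarith
  have hE3 : 2 * ε₁ * n ≤ ε / 2 * n := mul_le_mul_of_nonneg_right hE2 hn.le
  have hcomm : ε / 2 * n + n * (ε / 2) = n * ε := by ring
  linarith

/-! ## §2 Log-hearts ⇒ guarded ESTIMATE -/

/-- **The two log-shell hearts imply the packing-guarded ESTIMATE** (in-window bootstrap, no dilute self-consistency: the bands come from
the packing guard; uniform profile bounds on `[0,t]` + the a priori bound p125903; `P(s,s′) ≤ C(s′−s)M + 2ε₁(N+1)` from B2 (p133972) + the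
log-hearts at tolerance `ε₁ = ε⁴` and rate parameter `κ/16`; `H(r′) − H(s) ≤ P(s,r′)` from `ledgerFormula_Hent`; one bootstrap of the window
supremum; `A = 2(C₃+C₄) ≤ κ |log ε|`, `w = min 1 (ε/(2C²C₀+2CC₀+C+1))`, `bootstrap_consts`). [cite: Yau1991, §2] -/
theorem windowProductionEstimateLambdaInBand_of_heartsLog : Summit.AtomisticToContinuum.HydrodynamicLimit.Theorems.LambertianContactSwapLambertianEulerHeartsLog.KineticOneBlockInMeanLambdaLog → Summit.AtomisticToContinuum.HydrodynamicLimit.Theorems.LambertianContactSwapLambertianEulerHeartsLog.CollisionalOneBlockInMeanLambdaLog → Summit.AtomisticToContinuum.HydrodynamicLimit.Theorems.LambertianContactSwapLambertianEulerHeartsLog.WindowProductionEstimateLambdaInBand := by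
  intro h3 h4 r Rf hr hsol hbd hcont huniq
  -- the split, the two log-hearts and the smoothness of the explicit activity
  obtain ⟨ηb, hηb, HB⟩ := Summit.AtomisticToContinuum.HydrodynamicLimit.Theorems.LambertianContactSwapLambertianEulerProductionSplit.stub_productionSplitLambda r Rf hr hsol hbd hcont huniq
  obtain ⟨η3, hη3, H3⟩ := h3 r Rf hr hsol hbd hcont huniq
  obtain ⟨η4, hη4, H4⟩ := h4 r Rf hr hsol hbd hcont huniq
  obtain ⟨ηF, hηF, hηFr, Hsm⟩ := isSmoothSpaceTimeOn_activityRf hr huniq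
  -- THE BAND of the guarded estimate (what stmt-3091 used to supply)
  refine ⟨min ηb (min η3 (min η4 ηF)), lt_min hηb (lt_min hη3 (lt_min hη4 hηF)), ?_⟩
  intro a₀ θ₀ u₀ ha hθ hu ha0 hθ0
  obtain ⟨σ3, hσ3, H3⟩ := H3 a₀ θ₀ u₀ ha hθ hu ha0 hθ0
  obtain ⟨σ4, hσ4, H4⟩ := H4 a₀ θ₀ u₀ ha hθ hu ha0 hθ0
  refine ⟨min σ3 (min σ4 2⁻¹), lt_min hσ3 (lt_min hσ4 (by norm_num)), ?_⟩
  intro σ hσ hσlt T ρ θ u hE hband Φ htie t ht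
  have hσ3' : σ < σ3 := hσlt.trans_le (min_le_left _ _)
  have hσ4' : σ < σ4 := hσlt.trans_le ((min_le_right _ _).trans (min_le_left _ _))
  have hσi : σ < 2⁻¹ := hσlt.trans_le ((min_le_right _ _).trans (min_le_right _ _))
  have hσ3pos : 0 < σ ^ 3 := by positivity
  -- the packing bands, supplied by the guard
  have hbandb : ∀ t' ∈ Set.Ico 0 T, ∀ x, ρ t' x * σ ^ 3 < ηb := fun t' ht' x =>
    (hband t' ht' x).trans_le (min_le_left _ _)
  have hband3 : ∀ t' ∈ Set.Ico 0 T, ∀ x, ρ t' x * σ ^ 3 < η3 := fun t' ht' x =>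
    (hband t' ht' x).trans_le ((min_le_right _ _).trans (min_le_left _ _))
  have hband4 : ∀ t' ∈ Set.Ico 0 T, ∀ x, ρ t' x * σ ^ 3 < η4 := fun t' ht' x =>
    (hband t' ht' x).trans_le ((min_le_right _ _).trans ((min_le_right _ _).trans (min_le_left _ _)))
  have hbandF : ∀ t' ∈ Set.Ico 0 T, ∀ x, 0 < σ ^ 3 * ρ t' x ∧ σ ^ 3 * ρ t' x < ηF := fun t' ht' x =>
    ⟨mul_pos hσ3pos (hE.density_pos t' ht' x), by
      have h := (hband t' ht' x).trans_le ((min_le_right _ _).trans ((min_le_right _ _).trans (min_le_right _ _)))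
      nlinarith [h]⟩
  have hsmooth : Literature.Analysis.FunctionSpaces.Torus.IsSmoothSpaceTimeOn (Set.Ico 0 T)
      (fun r' x => ρ r' x * Rf (σ ^ 3 * ρ r' x)) := Hsm hE.smooth_density hbandF
  have hapos : ∀ t' ∈ Set.Ico 0 T, ∀ x, 0 < ρ t' x * Rf (σ ^ 3 * ρ t' x) := fun t' ht' x =>
    mul_pos (hE.density_pos t' ht' x)
      (hsol _ ⟨by linarith [(hbandF t' ht' x).1], (hbandF t' ht' x).2.trans_le hηFr⟩).1
  -- the log-hearts at this horizon
  have K3 := H3 σ hσ hσ3' T ρ θ u hE hband3 Φ htie t ht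
  have K4 := H4 σ hσ hσ4' T ρ θ u hE hband4 Φ htie t ht
  -- uniform profile bounds on `[0, t]` and the a priori entropy bound
  have h0tT : (0 : ℝ) + t < T := by rw [zero_add]; exact ht.2
  have hbne : ∀ p ∈ Set.Ico 0 T ×ˢ (Set.univ : Set V3),
      Literature.Analysis.FunctionSpaces.Torus.stLift (fun r' x => ρ r' x * Rf (σ ^ 3 * ρ r' x)) p ≠ 0 :=
    fun p hp => (hapos p.1 (Set.mem_prod.1 hp).1 _).ne'
  have hθne : ∀ p ∈ Set.Ico 0 T ×ˢ (Set.univ : Set V3),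
      Literature.Analysis.FunctionSpaces.Torus.stLift θ p ≠ 0 :=
    fun p hp => (hE.temperature_pos p.1 (Set.mem_prod.1 hp).1 _).ne'
  obtain ⟨B₁, hB₁, h₁⟩ :=
    Summit.AtomisticToContinuum.HydrodynamicLimit.Theorems.LambertianContactSwapLambertianEulerExpectedWindowProductionTools.exists_norm_le_of_continuousOn_window
      (hsmooth.continuousOn_stLift.log hbne) le_rfl h0tT
  obtain ⟨B₂, hB₂, h₂⟩ :=
    Summit.AtomisticToContinuum.HydrodynamicLimit.Theorems.LambertianContactSwapLambertianEulerExpectedWindowProductionTools.exists_norm_le_of_continuousOn_window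
      (hE.smooth_temperature.continuousOn_stLift.log hθne) le_rfl h0tT
  obtain ⟨W, hW, h₃⟩ :=
    Summit.AtomisticToContinuum.HydrodynamicLimit.Theorems.LambertianContactSwapLambertianEulerExpectedWindowProductionTools.exists_norm_le_of_continuousOn_window
      hE.smooth_velocity.continuousOn_stLift.norm le_rfl h0tT
  have hprof : ∀ r' ∈ Set.Icc 0 t, ∀ x : T3,
      (Real.exp (-(B₁ + B₂)) ≤ ρ r' x * Rf (σ ^ 3 * ρ r' x) ∧ ρ r' x * Rf (σ ^ 3 * ρ r' x) ≤ Real.exp (B₁ + B₂) + W) ∧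
      (Real.exp (-(B₁ + B₂)) ≤ θ r' x ∧ θ r' x ≤ Real.exp (B₁ + B₂) + W) ∧ ‖u r' x‖ ≤ Real.exp (B₁ + B₂) + W := by
    intro r' hr' x
    have hr'0 : r' ∈ Set.Icc 0 (0 + t) := by rw [zero_add]; exact hr'
    have hr'T : r' ∈ Set.Ico 0 T := ⟨hr'.1, hr'.2.trans_lt ht.2⟩
    have e₁ : Literature.Analysis.FunctionSpaces.Torus.stLift (fun r' x => ρ r' x * Rf (σ ^ 3 * ρ r' x))
        (r', Literature.Analysis.FunctionSpaces.Torus.repr x) = ρ r' x * Rf (σ ^ 3 * ρ r' x) := by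
      rw [Literature.Analysis.FunctionSpaces.Torus.stLift_apply, Literature.Analysis.FunctionSpaces.Torus.proj_repr]
    have e₂ : Literature.Analysis.FunctionSpaces.Torus.stLift θ (r', Literature.Analysis.FunctionSpaces.Torus.repr x) =
        θ r' x := by
      rw [Literature.Analysis.FunctionSpaces.Torus.stLift_apply, Literature.Analysis.FunctionSpaces.Torus.proj_repr]
    have e₃ : Literature.Analysis.FunctionSpaces.Torus.stLift u (r', Literature.Analysis.FunctionSpaces.Torus.repr x) =
        u r' x := by
      rw [Literature.Analysis.FunctionSpaces.Torus.stLift_apply, Literature.Analysis.FunctionSpaces.Torus.proj_repr]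
    have hl₁ : |Real.log (ρ r' x * Rf (σ ^ 3 * ρ r' x))| ≤ B₁ := by
      have h := h₁ r' hr'0 x; rwa [Real.norm_eq_abs, e₁] at h
    have hl₂ : |Real.log (θ r' x)| ≤ B₂ := by
      have h := h₂ r' hr'0 x; rwa [Real.norm_eq_abs, e₂] at h
    have hwx : ‖u r' x‖ ≤ W := by
      have h := h₃ r' hr'0 x
      rw [norm_norm, e₃] at h
      exact h
    have hb0 : 0 < ρ r' x * Rf (σ ^ 3 * ρ r' x) := hapos r' hr'T x
    have hθ0' : 0 < θ r' x := hE.temperature_pos r' hr'T x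
    have hl₁' := abs_le.1 hl₁
    have hl₂' := abs_le.1 hl₂
    have hexp0 : 0 ≤ Real.exp (B₁ + B₂) := (Real.exp_pos _).le
    have hexpW : Real.exp (B₁ + B₂) ≤ Real.exp (B₁ + B₂) + W := le_add_of_nonneg_right hW
    refine ⟨⟨?_, ?_⟩, ⟨?_, ?_⟩, ?_⟩
    · calc Real.exp (-(B₁ + B₂)) ≤ Real.exp (Real.log (ρ r' x * Rf (σ ^ 3 * ρ r' x))) :=
            Real.exp_le_exp.2 (by linarith)
        _ = ρ r' x * Rf (σ ^ 3 * ρ r' x) := Real.exp_log hb0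
    · calc ρ r' x * Rf (σ ^ 3 * ρ r' x) = Real.exp (Real.log (ρ r' x * Rf (σ ^ 3 * ρ r' x))) :=
            (Real.exp_log hb0).symm
        _ ≤ Real.exp (B₁ + B₂) := Real.exp_le_exp.2 (by linarith)
        _ ≤ Real.exp (B₁ + B₂) + W := hexpW
    · calc Real.exp (-(B₁ + B₂)) ≤ Real.exp (Real.log (θ r' x)) := Real.exp_le_exp.2 (by linarith)
        _ = θ r' x := Real.exp_log hθ0'
    · calc θ r' x = Real.exp (Real.log (θ r' x)) := (Real.exp_log hθ0').symm
        _ ≤ Real.exp (B₁ + B₂) := Real.exp_le_exp.2 (by linarith)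
        _ ≤ Real.exp (B₁ + B₂) + W := hexpW
    · linarith
  obtain ⟨C₀', HC₀⟩ := Summit.AtomisticToContinuum.HydrodynamicLimit.Theorems.LambertianContactSwapLambertianEulerAprioriEntropyBound.stub_aprioriEntropyBoundLambda hσ hσi ha hθ hu ha0 hθ0 (Real.exp (-(B₁ + B₂)))
    (Real.exp (B₁ + B₂) + W) (Real.exp_pos _)
  have hapr : ∀ (N : ℕ), ∀ r' ∈ Set.Icc 0 t,
      Hent σ a₀ θ₀ u₀ Rf ρ θ u N (Φ N) r' ≤ max C₀' 0 * ((N : ℝ) + 1) := by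
    intro N r' hr'
    have hr'T : r' ∈ Set.Ico 0 T := ⟨hr'.1, hr'.2.trans_lt ht.2⟩
    have hbc : Continuous fun x => ρ r' x * Rf (σ ^ 3 * ρ r' x) := (hsmooth.isSmooth_slice hr'T).continuous
    have hθc : Continuous (θ r') := (hE.smooth_temperature.isSmooth_slice hr'T).continuous
    have huc : Continuous (u r') := (hE.smooth_velocity.isSmooth_slice hr'T).continuous
    have h := (HC₀ hbc hθc huc (fun x => (hprof r' hr' x).1) (fun x => (hprof r' hr' x).2.1)
      (fun x => (hprof r' hr' x).2.2) N (Φ N) r' hr'.1).2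
    have hN0 : (0 : ℝ) ≤ (N : ℝ) + 1 := by positivity
    exact h.trans (mul_le_mul_of_nonneg_right (le_max_left _ _) hN0)
  -- abbreviations for the a priori constant
  have hC₀ : 0 ≤ max C₀' 0 := le_max_right _ _
  generalize hC₀_def : max C₀' 0 = C₀ at hC₀ hapr
  -- the rate parameter: hearts at `κ/16`, tolerance `ε⁴`
  intro κ hκ
  obtain ⟨ε3, hε3, K3⟩ := K3 (κ / 16) (by positivity)
  obtain ⟨ε4, hε4, K4⟩ := K4 (κ / 16) (by positivity)
  have hD : 0 < 8 * (2 * C₀ * κ ^ 2 + 2 * C₀ * κ + κ + 1) := by positivity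
  refine ⟨min (1 / 2) (min ε3 (min ε4 (1 / (8 * (2 * C₀ * κ ^ 2 + 2 * C₀ * κ + κ + 1))))),
    lt_min (by norm_num) (lt_min hε3 (lt_min hε4 (by positivity))), fun ε hε hεlt => ?_⟩
  have hεhalf : ε ≤ 1 / 2 := (hεlt.trans_le (min_le_left _ _)).le
  have hε3' : ε < ε3 := hεlt.trans_le ((min_le_right _ _).trans (min_le_left _ _))
  have hε4' : ε < ε4 := hεlt.trans_le ((min_le_right _ _).trans ((min_le_right _ _).trans (min_le_left _ _)))
  have hεD : ε ≤ 1 / (8 * (2 * C₀ * κ ^ 2 + 2 * C₀ * κ + κ + 1)) :=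
    (hεlt.trans_le ((min_le_right _ _).trans ((min_le_right _ _).trans (min_le_right _ _)))).le
  have hεsmall : ε * (8 * (2 * C₀ * κ ^ 2 + 2 * C₀ * κ + κ + 1)) ≤ 1 := (le_div_iff₀ hD).1 hεD
  have hε1 : ε ≤ 1 := hεhalf.trans (by norm_num)
  have hε4le : ε ^ 4 ≤ ε := by
    have := pow_le_pow_of_le_one hε.le hε1 (show 1 ≤ 4 by norm_num)
    rwa [pow_one] at this
  have hε₁ : 0 < ε ^ 4 := by positivity
  obtain ⟨C3, hC3, hC3le, N3, hN3⟩ := K3 (ε ^ 4) hε₁ (hε4le.trans_lt hε3')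
  obtain ⟨C4, hC4, hC4le, N4, hN4⟩ := K4 (ε ^ 4) hε₁ (hε4le.trans_lt hε4')
  -- `C = C₃ + C₄ ≤ (κ/2)|log ε|`, `A = 2C ≤ κ |log ε|`
  have hlog4 : |Real.log (ε ^ 4)| = 4 * |Real.log ε| := by
    rw [Real.log_pow, abs_mul]; norm_num
  have hC : 0 ≤ C3 + C4 := add_nonneg hC3 hC4
  have hCle : C3 + C4 ≤ κ / 2 * |Real.log ε| := by rw [hlog4] at hC3le hC4le; linarith
  generalize hC_def : C3 + C4 = C at hC hCle
  -- the window (constant in `N`) and the pure-ℝ consistency of the constants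
  have hden : 0 < 2 * C ^ 2 * C₀ + 2 * C * C₀ + C + 1 := by positivity
  have hw₀ : 0 < min 1 (ε / (2 * C ^ 2 * C₀ + 2 * C * C₀ + C + 1)) := lt_min one_pos (div_pos hε hden)
  have hw₁ : min 1 (ε / (2 * C ^ 2 * C₀ + 2 * C * C₀ + C + 1)) ≤ 1 := min_le_left _ _
  obtain ⟨hkey₁, hkey₁', hkey₂⟩ := bootstrap_consts hC hC₀ hκ hε hεhalf hCle hεsmall
  generalize hw_def : min 1 (ε / (2 * C ^ 2 * C₀ + 2 * C * C₀ + C + 1)) = w₀ at hw₀ hw₁ hkey₁ hkey₁' hkey₂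
  generalize hε₁_def : ε ^ 4 = ε₁ at hε₁ hN3 hN4 hkey₂
  refine ⟨2 * C, by positivity, by linarith, fun _ => w₀, fun _ => hw₀, max N3 N4, fun N hN => ?_⟩
  have hN3' : N3 ≤ N := (le_max_left _ _).trans hN
  have hN4' : N4 ≤ N := (le_max_right _ _).trans hN
  have hN1 : (0 : ℝ) < (N : ℝ) + 1 := by positivity
  -- (P) the production of a sub-interval, given an entropy bound on it
  have hP : ∀ (s s' M : ℝ), 0 ≤ s → s ≤ s' → s' ≤ t →
      (∀ r' ∈ Set.Icc s s', Hent σ a₀ θ₀ u₀ Rf ρ θ u N (Φ N) r' ≤ M) →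
      dLZ σ Rf ρ N s s' - Sint σ a₀ θ₀ u₀ Rf ρ θ u T N (Φ N) s s' - Jmp σ a₀ θ₀ u₀ Rf ρ θ u N (Φ N) s s' ≤
        C * (s' - s) * M + 2 * ε₁ * ((N : ℝ) + 1) := by
    intro s s' M hs hss' hs't hM
    have hs'T : s' < T := hs't.trans_lt ht.2
    have hsplit : Sint σ a₀ θ₀ u₀ Rf ρ θ u T N (Φ N) s s' =
        Yint σ a₀ θ₀ u₀ θ u N (Φ N) s s' - Xint σ a₀ θ₀ u₀ ρ θ u N (Φ N) s s' :=
      (HB hσ hσi ha hθ hu ha0 hθ0 T N (Φ N) ρ θ u hE hbandb s s' hs hss' hs'T).2.2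
    have k3 : -(Yint σ a₀ θ₀ u₀ θ u N (Φ N) s s') ≤ C3 * (s' - s) * M + ε₁ * ((N : ℝ) + 1) :=
      hN3 N hN3' s s' M hs hss' hs't hM
    have k4 : -(Jmp σ a₀ θ₀ u₀ Rf ρ θ u N (Φ N) s s') + Xint σ a₀ θ₀ u₀ ρ θ u N (Φ N) s s' + dLZ σ Rf ρ N s s' ≤
        C4 * (s' - s) * M + ε₁ * ((N : ℝ) + 1) :=
      hN4 N hN4' s s' M hs hss' hs't hM
    rw [← hC_def]
    linarith
  constructor
  · -- full windows `[s, s + w₀] ⊆ [0, t]`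
    intro s hs hsw
    beta_reduce
    beta_reduce at hsw
    -- crude bound on the window from the a priori bound, then bootstrap once
    have hM₁ : ∀ r' ∈ Set.Icc s (s + w₀), Hent σ a₀ θ₀ u₀ Rf ρ θ u N (Φ N) r' ≤
        Hent σ a₀ θ₀ u₀ Rf ρ θ u N (Φ N) s + C * w₀ * (C₀ * ((N : ℝ) + 1)) + 2 * ε₁ * ((N : ℝ) + 1) := by
      intro r' hr'
      have hl := ledgerFormula_Hent hσ hσi ha hθ hu ha0 hθ0 hE hsmooth hapos N (Φ N) hs hr'.1
        ((hr'.2.trans hsw).trans_lt ht.2)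
      have hp := hP s r' (C₀ * ((N : ℝ) + 1)) hs hr'.1 (hr'.2.trans hsw)
        (fun r'' hr'' => hapr N r'' ⟨hs.trans hr''.1, (hr''.2.trans hr'.2).trans hsw⟩)
      have hX : 0 ≤ C₀ * ((N : ℝ) + 1) := by positivity
      have hcr : C * (r' - s) * (C₀ * ((N : ℝ) + 1)) ≤ C * w₀ * (C₀ * ((N : ℝ) + 1)) :=
        mul_le_mul_of_nonneg_right (mul_le_mul_of_nonneg_left (by linarith [hr'.2]) hC) hX
      linarith [hl, hp, hcr]
    have hfin := hP s (s + w₀) _ hs (by linarith) hsw hM₁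
    rw [show s + w₀ - s = w₀ by ring] at hfin
    exact estimate_arith_full_le hC hw₀ hN1 ENNReal.toReal_nonneg hfin hkey₁ hkey₂
  · -- the last partial window `s ≤ t ≤ s + w₀`
    intro s hs hst htsw
    beta_reduce at htsw
    have hp := hP s t (C₀ * ((N : ℝ) + 1)) hs hst le_rfl (fun r'' hr'' => hapr N r'' ⟨hs.trans hr''.1, hr''.2⟩)
    exact estimate_arith_partial_le hC hC₀ hw₀ hw₁ hN1 hε hε₁.le (by linarith) hp hkey₁' hkey₂

end Summit.AtomisticToContinuum.HydrodynamicLimit.Theorems.LambertianContactSwapLambertianEulerEstimateOfHeartsLog
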